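import Literature.MathematicalPhysics.QuantumFieldTheory.Balaban1983to89.B6Prop22KLevelCensusEta
import Literature.MathematicalPhysics.QuantumFieldTheory.Balaban1983to89.B6Prop22SixMultiLevelBoxRateUnif

/-!
# `Balaban1983to89.B6Prop22KLevelCensusEtaUnif` — [B6] PROPOSITION 2.2 IN ITS CENSUS TYPING, **VERBATIM**
(`B6.Prop22Printed`: `∃ M₁ δ₀ C, ∃ Cα : ℝ → ℝ, ∀ members, ∀ α`), ON THE GENUINE `k`-LEVEL FAMILY `KIdx` IN PRINT'S UNITS
(`geoP`/`gpP`, `η = L^{−k}`) — the Hölder conjunct with ONE threshold and ONE rate for ALL `0 ≤ α < 1` from p21's `_unif`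
k-level chain, then the census sentence itself (no existing module is touched; no fact is minted; no new definition)

FRAMING (verbatim cell line):
statement-level skeleton of published theorems with citation tags; proofs where landed; nothing here is a claim about the Yang–Mills mass gap

Source under audit (cell pub-balaban / lit-balaban): T. Bałaban, *Propagators and renormalization transformations for
lattice gauge theories. II*, Commun. Math. Phys. **96** (1984) 223–250 [`Balaban1984PropagatorsII`, "B6"], p. 234
[PDF 12] Proposition 2.2 (2.67); p. 224 [PDF 2] (2.1)–(2.2); p. 231 [PDF 9] (2.46) (renders
`run/shared/lean/pub/pub-balaban/b2b-balaban-ref1/pages/1984-cmp96-propagators-rt-II/…-p002/p009/p012-x2.png`);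
[`Balaban1984PropagatorsI`] (1.109) p. 35 (the Hölder norm); [3] = T. Bałaban, *Regularity and decay of lattice Green's
functions*, Commun. Math. Phys. **89** (1983) 571–597 [`Balaban1983RegularityDecay`], Theorem (1.9) p. 573 («δ₀, c₀, R₀ …
depending on d, M only, c₀ on α also»).  PDF held: `paper:balaban1984-cmp96-propagators-rt-ii` (journal page = PDF page
+ 222).  Unit `lit-balaban-p21` (Phase-2 proof seat p21 gen 12), HOME `run/shared/lean/pub/lit-balaban/`, B6 fold owner
r03 (row **B6.Prop2.2**; r03's `…B6Prop22KLevelCensus` / `…B6Prop22KLevelCensusEta` own the family and the dictionary —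
`KIdx`, `geoP`, `gpP`, `prop22_supEntries_kLevelP`, the Hölder plumbing `hqP_le_of_forall` / `hqBP_le_of_forall` /
`hHP_le_of_forall` / `holder_pair_boundP` / `quot_eq_weight` / `eta_weight` are consumed BY NAME), referee ref-4.

## WHAT IS PRINTED (p. 234, verbatim up to notation)

«**Proposition 2.2.** If we have (2.1), (2.2) and M is sufficiently large, then the operator G′ = Δ′_a^{−1} (a = 1)
satisfies the inequalities |(G′λ)(x)|, |(∇^η_xG′λ)(x)|, |(G′∇^{η*}λ)(x)|, ‖ζ∇^η_xG′λ‖_α, ‖ζG′∇^{η*}λ‖_α, |(Δ^ηG′λ)(x)|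
≤ O(1)[(L^jη)², L^jη, L^jη, (L^jη)^{1−α}(‖ζ‖_α + |ζ|), (L^jη)^{1−α}(‖ζ‖_α + |ζ|), 1]·e^{−½δ₀d(y,y′)}|λ|, x ∈ B^j(y) or
supp ζ ⊂ B^j(y), y ∈ Λ_j, supp λ ⊂ B^{j′}(y′), y′ ∈ Λ_{j′}. (2.67)»

## WHAT THIS FILE CERTIFIES (kernel-checked)

* §1 **`prop22_holderEntries_kLevelP_unif`** — the HÖLDER CONJUNCT of the census sentence on the genuine `k`-level family
  in print's units, IN PRINT'S ORDER: `∃ M₁ δ₀ > 0 ∀ α ∈ [0,1) ∃ C(α) > 0 ∀ i, M₁ ≤ M → ∀ λ ζ y y′ (supp ζ ⊂ B(y),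
  supp λ ⊂ B(y′)): max_μ max(‖ζ∇^η_μG′λ‖_α, ‖ζG′∇^{η*}_μλ‖_α) ≤ C·(L^jη)^{1−α}·(‖ζ‖_α + |ζ|)·e^{−½δ₀d(y,y′)}·|λ|` — r03's
  `prop22_holderEntries_kLevelP` (per `α`) with its input replaced by p21's
  `B6Prop22SixMultiLevelBoxRateUnif.prop22_six_pointwise_multiLevelBox_unif` (entries 2, 3 as majorants with one `C`,
  entries 4, 5 on the pairs with `C_α`, one `δ₀`, `M₀`, `N₀` for all `α`); proof = r03's (product rule
  `holder_pair_boundP`, `L^jη ≤ 1` on the `‖ζ‖_α` term) with the `∃`-witnesses reordered.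
* §2 **`prop22Printed_kLevelP : B6.Prop22Printed (fun i : KIdx d ℓ => geoP i) (fun i => gpP i)`** — THE CENSUS
  SENTENCE OF PROPOSITION 2.2, VERBATIM (`∃ M₁ δ₀ C, ∃ Cα : ℝ → ℝ, … ∀ α ∈ [0,1)`), for the GENUINE `k`-LEVEL OPERATOR
  `G′ = Δ′_a^{−1}` on EVERY nested family (2.1)–(2.2) of the box, every number of levels `k`: the sup conjunct is r03's
  `prop22_supEntries_kLevelP`, the Hölder conjunct is §1, `Cα` the choice function of §1's constants (pattern: r03's
  `B6Prop22TwoLevelCensusUpTo.prop22Printed_twoLevel_of_holderUnif`); `M₁ := max`, `δ₀ := min`.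
  Non-vacuity of the family beyond every threshold: r03's `B6Prop22KLevelCensusEta.kLevelP_nonvacuous`.

## HONEST SCOPE

The family, the units and the reading are r03's (`…B6Prop22KLevelCensusEta` HONEST SCOPE (2)–(3)): ALL nested block-union
families (2.1)–(2.2) of the Neumann box (the torus is not treated), levels `1 … k` (print `0 … k`), `A = 0`, `m² = 0`,
printed weights `a = 1`, reading R2 of (2.46) (p21's realised distance), entries 3/5 per component `μ`, forward
differences along bonds of the box, `η = L^{−k}`; constants existential (`M₁`, `δ₀`, `C` depend on `d`, `L`; `Cα` also on
`α` — print: «O(1)» depends on `α`, «δ₀» does not, [3] p. 573).  The (2.61)-constant behind the chain is the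
`L`-dependent one of `B6Ineq261LevelGap`.  No new estimate: the conjunction / re-ordering of landed theorems.  NOT summit
progress.
-/

noncomputable section

open scoped BigOperators
open Finset Matrix

namespace Literature.MathematicalPhysics.QuantumFieldTheory.Balaban1983to89.B6Prop22KLevelCensusEtaUnif

open Literature.MathematicalPhysics.QuantumFieldTheory.Balaban1983to89.B4ContourShift (supNorm abs_le_supNorm supNorm_nonneg)
open Literature.MathematicalPhysics.QuantumFieldTheory.Balaban1983to89.B4Reflection242 (boxDom mem_boxDom)
open Literature.MathematicalPhysics.QuantumFieldTheory.Balaban1983to89.B4Lemma22ZeroBoxDerivDual (fwd fwd_val_of_mem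
  fwd_of_not_mem)
open Literature.MathematicalPhysics.QuantumFieldTheory.Balaban1983to89.B6MultiLevelBoxOperator (N0 Domains aPrinted
  aPrinted_window aPrinted_succ gml)
open Literature.MathematicalPhysics.QuantumFieldTheory.Balaban1983to89.B6Geom246MultiLevelBox (bset blkOf geom bond
  scale_bounds lev_eq_of_blkOf_eq)
open Literature.MathematicalPhysics.QuantumFieldTheory.Balaban1983to89.B6Ineq243TwoLevelBox (aNext)
open Literature.MathematicalPhysics.QuantumFieldTheory.Balaban1983to89.B6Ineq243AdjTwoLevelBox (dstar dstar_apply)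
open Literature.MathematicalPhysics.QuantumFieldTheory.Balaban1983to89.B6Prop22DerivMultiLevelBox (dMat dMat_mulVec_of_mem
  dMat_mulVec_of_not_mem)
open Literature.MathematicalPhysics.QuantumFieldTheory.Balaban1983to89.B6RandomWalk (HasMajorant BlockSupp)
open Literature.MathematicalPhysics.QuantumFieldTheory.Balaban1983to89.B6Prop22SixMultiLevelBoxRateUnif
  (prop22_six_pointwise_multiLevelBox_unif)
open Literature.MathematicalPhysics.QuantumFieldTheory.Balaban1983to89.B6Prop22KLevelCensus (KIdx kLevel_nonvacuous)
open Literature.MathematicalPhysics.QuantumFieldTheory.Balaban1983to89.B6Prop22KLevelCensusEta (nK one_le_nK nK_pos hqP hqBP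
  dG Gd hHP geoP gpP geoP_len len_pos len_le_one gpP_e gpP_h1 prop22_supEntries_kLevelP hqP_nonneg pair_le_hqP
  quot_eq_weight hqP_le_of_forall hqBP_le_of_forall hHP_le_of_forall holder_pair_boundP eta_weight)
open Literature.MathematicalPhysics.QuantumFieldTheory.Balaban1983to89.B6 (Geometry GpFamily Prop22Printed pref4)

variable {d : ℕ}

/-! ## §0 Tools (private copies of r03's non-importable plumbing) -/

section Tools

variable {ℓ : ℕ} (i : KIdx d ℓ)

/-- `0 ≤ |λ|`. [cite: Balaban1984PropagatorsII, Prop. 2.2 (2.67) p.234 («|λ|»), dictionary] -/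
private theorem supF_nonneg (f : ↥(i.XB) → ℝ) : 0 ≤ i.supF f := by
  unfold KIdx.supF
  exact le_ciSup_of_le (Set.finite_range _).bddAbove i.origin (abs_nonneg _)

/-- `|λ(x)| ≤ |λ|`. [cite: Balaban1984PropagatorsII, Prop. 2.2 (2.67) p.234 («|λ|»), dictionary] -/
private theorem abs_le_supF (f : ↥(i.XB) → ℝ) (x : ↥(i.XB)) : |f x| ≤ i.supF f :=
  le_ciSup (Set.finite_range fun x : ↥(i.XB) => |f x|).bddAbove x

end Tools

/-! ## §1 The Hölder conjunct on the genuine `k`-level family in print's units — one threshold, one rate for all `α` -/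

/-- **PROPOSITION 2.2 (2.67), THE HÖLDER ENTRIES 4 AND 5, IN THE CENSUS TYPING ON THE GENUINE `k`-LEVEL FAMILY (PRINT'S
UNITS), IN PRINT'S QUANTIFIER ORDER**: there are `M₁, δ₀ > 0` (depending on `d`, `L`) such that for every `0 ≤ α < 1`
there is `C = C(α) > 0` with: for EVERY nested family (2.1)–(2.2) on the box with `M = L·M_h ≥ M₁`, every `λ` with
`supp λ ⊂ B(y′)`, every cut-off `ζ` with `supp ζ ⊂ B(y)`:
`max_μ max(‖ζ∇^η_μG′λ‖_α, ‖ζG′∇^{η*}_μλ‖_α) ≤ C·(L^jη)^{1−α}·(‖ζ‖_α + |ζ|)·e^{−½δ₀d(y,y′)}·|λ|`.  From p21's `_unif` six-entry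
package — entries 2, 3 (`sup_{B(y)}|∇G′λ|, |G′∇*λ| = O(L^j)` lattice, `= O(L^jη)` print, one `C`) and entries 4, 5 on
the pairs of one block (`O((L^j)^{1−α})` lattice, `= O((L^jη)^{1−α})` print, `C_α`) at ONE `δ₀, M₀, N₀` — by the product
rule `holder_pair_boundP`, with `L^jη ≤ (L^jη)^{1−α}` (`L^jη ≤ 1`) on the `‖ζ‖_α` term, exactly as in print; r03's
per-`α` proof with the `∃`-witnesses reordered.
[cite: Balaban1984PropagatorsII, Prop. 2.2 (2.67) p.234 (entries 4, 5); (2.46) p.231; Balaban1983RegularityDecay, Thm (1.9) p.573] -/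
theorem prop22_holderEntries_kLevelP_unif (d ℓ : ℕ) (hℓ : 1 ≤ ℓ) :
    ∃ M₁ δ₀ : ℝ, 0 < M₁ ∧ 0 < δ₀ ∧ ∀ (α : ℝ), 0 ≤ α → α < 1 → ∃ C : ℝ, 0 < C ∧
      ∀ i : KIdx d ℓ, (geoP i).Hyp21_22 → M₁ ≤ (geoP i).M →
        ∀ (lam : (geoP i).Loc) (ζ : (geoP i).Cut) (y y' : (geoP i).Site), (geoP i).cutIn ζ y → (geoP i).suppIn lam y' →
          (gpP i).h1 lam α ζ ≤ C * ((geoP i).len y) ^ (1 - α) * (geoP i).cutH α ζ *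
            Real.exp (-(δ₀ / 2 * (geoP i).dist y y')) * (geoP i).supNorm lam := by
  classical
  -- the windows of the printed weights
  set amin : ℝ := 1 - ((((ℓ : ℝ) + 1)) ^ 2)⁻¹ with hamin_def
  have hL2 : (1 : ℝ) < (((ℓ : ℝ) + 1)) ^ 2 := by
    have : (2 : ℝ) ≤ (ℓ : ℝ) + 1 := by
      have : (1 : ℝ) ≤ ℓ := by exact_mod_cast hℓ
      linarith
    nlinarith
  have hamin : 0 < amin := by
    rw [hamin_def, sub_pos]
    exact inv_lt_one_of_one_lt₀ hL2
  obtain ⟨hwin, hrec⟩ := B6Prop22KLevelCensus.KIdx.aPrinted_windows hℓ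
  -- p21's `_unif` package: entries 2, 3 as majorants (one `C`), entries 4, 5 on the pairs (`C_α`), ONE `δ₀, M₀, N₀`
  obtain ⟨δ₀, Ca, Ma, Na, hδ₀, hCa, hMa, hNa, hA, hHA⟩ :=
    prop22_six_pointwise_multiLevelBox_unif d ℓ hℓ amin 1 1 1 hamin one_pos
  set M₁ : ℝ := max (max Ma (((Na : ℕ) : ℝ) + 1)) (3 * ((ℓ : ℝ) + 1)) with hM₁_def
  refine ⟨M₁, δ₀, lt_of_lt_of_le hMa (le_trans (le_max_left _ _) (le_max_left _ _)), hδ₀, fun α hα0 hα1 => ?_⟩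
  obtain ⟨Cb, hCb, hB⟩ := hHA α hα0 hα1
  set CC : ℝ := Ca + Cb with hCC_def
  have hCC : 0 < CC := by positivity
  refine ⟨CC, hCC, ?_⟩
  intro i _ hM lam ζ y y' hcut hsupp
  change ↥(i.XB) → ℝ at lam
  change ↥(i.XB) → ℝ at ζ
  change ↥(bset i.D) at y
  change ↥(bset i.D) at y'
  change M₁ ≤ ((ℓ : ℝ) + 1) * i.Mh at hM
  change ∀ w, ζ w ≠ 0 → blkOf i.D w = y at hcut
  change ∀ x, lam x ≠ 0 → blkOf i.D x = y' at hsupp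
  -- «M sufficiently large» for both packages
  have hMa' : Ma ≤ ((ℓ : ℝ) + 1) * i.Mh := le_trans (le_trans (le_max_left _ _) (le_max_left _ _)) hM
  have hLpos : (0 : ℝ) < (ℓ : ℝ) + 1 := by positivity
  have hMh3 : 3 ≤ i.Mh := by
    have h3 : 3 * ((ℓ : ℝ) + 1) ≤ ((ℓ : ℝ) + 1) * i.Mh := le_trans (le_max_right _ _) hM
    have : (3 : ℝ) ≤ i.Mh := by nlinarith
    exact_mod_cast this
  have hMh1 : 1 ≤ i.Mh := le_trans (by norm_num) hMh3
  have hRM : ∀ N : ℕ, N ≤ Na → N + 1 ≤ i.R * ((ℓ + 1) * i.Mh) := by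
    intro N hN
    have h1 : (((Na : ℕ) : ℝ) + 1) ≤ ((ℓ : ℝ) + 1) * i.Mh :=
      le_trans (le_trans (le_max_right _ _) (le_max_left _ _)) hM
    have h2 : Na + 1 ≤ (ℓ + 1) * i.Mh := by exact_mod_cast h1
    have hR1 : 1 ≤ i.R := le_trans (by omega) i.hR
    calc N + 1 ≤ 1 * ((ℓ + 1) * i.Mh) := by rw [one_mul]; omega
      _ ≤ i.R * ((ℓ + 1) * i.Mh) := Nat.mul_le_mul_right _ hR1
  obtain ⟨-, h2, h3, -⟩ := hA i.k i.Mh i.R hMh3 hMa' i.hR (hRM Na le_rfl) i.P i.hP i.D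
    (aPrinted ℓ 1) (fun _ => 1) hwin (fun j _ => ⟨le_rfl, le_rfl⟩) hrec
  have hpt := hB i.k i.Mh i.R hMh3 hMa' i.hR (hRM Na le_rfl) i.P i.hP i.D
    (aPrinted ℓ 1) (fun _ => 1) hwin (fun j _ => ⟨le_rfl, le_rfl⟩) hrec
  have hBS := i.blockSupp_of_suppIn lam y' hsupp
  -- the common shape of the target
  set n : ℝ := ((nK i : ℕ) : ℝ) with hn_def
  have hn : 0 < n := nK_pos i
  set t : ℝ := (geoP i).len y with ht_def
  have ht : t = ((ℓ : ℝ) + 1) ^ y.1.1 * n⁻¹ := geoP_len i y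
  have ht0 : 0 < t := len_pos i y
  have ht1 : t ≤ 1 := len_le_one i y
  have hLj0 : (0 : ℝ) ≤ ((ℓ : ℝ) + 1) ^ y.1.1 := by positivity
  set E : ℝ := Real.exp (-(δ₀ / 2 * (geoP i).dist y y')) with hE_def
  have hdist0 : 0 ≤ (geom i.D).dist y y' := by
    change (0 : ℝ) ≤ (((bond i.D).dist y y' : ℕ) : ℝ); exact Nat.cast_nonneg _
  have hEmono : ∀ δ : ℝ, δ₀ ≤ δ → Real.exp (-(δ / 2 * (geom i.D).dist y y')) ≤ E := by
    intro δ hδ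
    rw [hE_def]; apply Real.exp_le_exp.2
    change -(δ / 2 * (geom i.D).dist y y') ≤ -(δ₀ / 2 * (geom i.D).dist y y')
    have := mul_le_mul_of_nonneg_right (div_le_div_of_nonneg_right hδ (by norm_num : (0 : ℝ) ≤ 2)) hdist0
    linarith
  have hEa := hEmono δ₀ le_rfl
  have hEb := hEmono δ₀ le_rfl
  have hS0 := supF_nonneg i lam
  change hHP i lam α ζ ≤ CC * t ^ (1 - α) * (hqP i α ζ + i.supF ζ) * E * i.supF lam
  -- the common per-pair bound `B = CC·t^{1−α}·E·|λ|`
  set B : ℝ := CC * t ^ (1 - α) * E * i.supF lam with hB_def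
  have htα : 0 ≤ t ^ (1 - α) := Real.rpow_nonneg ht0.le _
  have hE0 : 0 ≤ E := (Real.exp_pos _).le
  have hB0 : 0 ≤ B := by positivity
  have ht_le : t ≤ t ^ (1 - α) := by
    have h := Real.rpow_le_rpow_of_exponent_ge ht0 ht1 (by linarith : 1 - α ≤ 1)
    rwa [Real.rpow_one] at h
  -- sup bounds (entries 2, 3): `|η·F(x)| ≤ Ca·L^jη·E·|λ| ≤ B` on `B(y)`
  have hCa_le : Ca ≤ CC := by rw [hCC_def]; linarith
  have hCb_le : Cb ≤ CC := by rw [hCC_def]; linarith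
  have sup_to_B : ∀ v : ℝ, |v| ≤ Ca * ((ℓ : ℝ) + 1) ^ y.1.1 * Real.exp (-(δ₀ / 2 * (geom i.D).dist y y')) * i.supF lam →
      |n⁻¹ * v| ≤ B := by
    intro v hv
    rw [abs_mul, abs_of_pos (inv_pos.2 hn)]
    calc n⁻¹ * |v| ≤ n⁻¹ * (Ca * ((ℓ : ℝ) + 1) ^ y.1.1 * Real.exp (-(δ₀ / 2 * (geom i.D).dist y y')) * i.supF lam) :=
          mul_le_mul_of_nonneg_left hv (inv_nonneg.2 hn.le)
      _ = Ca * t * Real.exp (-(δ₀ / 2 * (geom i.D).dist y y')) * i.supF lam := by rw [ht]; ring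
      _ ≤ CC * t ^ (1 - α) * E * i.supF lam := by
          have h1 : Ca * t ≤ CC * t ^ (1 - α) := mul_le_mul hCa_le ht_le ht0.le hCC.le
          exact mul_le_mul (mul_le_mul h1 hEa (Real.exp_pos _).le (by positivity)) le_rfl hS0 (by positivity)
  -- pair bounds (entries 4, 5): `n^α·s^{−α}|F(x′)−F(x)|·η ≤ Cb·(L^jη)^{1−α}·E·|λ| ≤ B` on the pairs of `B(y)`
  have pair_to_B : ∀ (s v : ℝ), s ^ (-α) * |v| ≤ Cb * (((ℓ : ℝ) + 1) ^ y.1.1) ^ (1 - α)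
        * Real.exp (-(δ₀ / 2 * (geom i.D).dist y y')) * i.supF lam →
      n ^ α * s ^ (-α) * |n⁻¹ * v| ≤ B := by
    intro s v hv
    rw [abs_mul, abs_of_pos (inv_pos.2 hn)]
    have hnα : 0 ≤ n ^ α := Real.rpow_nonneg hn.le _
    calc n ^ α * s ^ (-α) * (n⁻¹ * |v|) = n⁻¹ * n ^ α * (s ^ (-α) * |v|) := by ring
      _ ≤ n⁻¹ * n ^ α * (Cb * (((ℓ : ℝ) + 1) ^ y.1.1) ^ (1 - α)
          * Real.exp (-(δ₀ / 2 * (geom i.D).dist y y')) * i.supF lam) :=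
          mul_le_mul_of_nonneg_left hv (by positivity)
      _ = Cb * (n⁻¹ * n ^ α * (((ℓ : ℝ) + 1) ^ y.1.1) ^ (1 - α))
          * Real.exp (-(δ₀ / 2 * (geom i.D).dist y y')) * i.supF lam := by ring
      _ = Cb * t ^ (1 - α) * Real.exp (-(δ₀ / 2 * (geom i.D).dist y y')) * i.supF lam := by
          rw [eta_weight hn hLj0 α, ← ht]
      _ ≤ CC * t ^ (1 - α) * E * i.supF lam :=
          mul_le_mul (mul_le_mul (mul_le_mul_of_nonneg_right hCb_le htα) hEb (Real.exp_pos _).le (by positivity))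
            le_rfl hS0 (by positivity)
  have hbound : hqP i α ζ * B + i.supF ζ * B = CC * t ^ (1 - α) * (hqP i α ζ + i.supF ζ) * E * i.supF lam := by
    rw [hB_def]; ring
  rw [← hbound]
  have hBB : 0 ≤ hqP i α ζ * B + i.supF ζ * B := by
    have := hqP_nonneg i α ζ; have := supF_nonneg i ζ; positivity
  refine hHP_le_of_forall i lam α ζ (fun μ => ?_) (fun μ => ?_)
  · -- entry 4: `ζ·∇^η_μG′λ`, bond pairs
    refine hqBP_le_of_forall i μ α _ hBB fun x x' hne hxm hxm' => ?_
    have hne' : x'.1 ≠ x.1 := fun h => hne (Subtype.ext h).symm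
    refine holder_pair_boundP i α ζ (dG i μ lam) y hcut x x' hne hB0 hB0 ?_ ?_ ?_
    · intro hx
      have h := h2 μ y' lam (i.supF lam) hBS x
      rw [Matrix.toLin'_apply, hx] at h
      simp only at h
      show |dG i μ lam x| ≤ B
      unfold dG
      rw [← i.dMat_G_mulVec]
      exact sup_to_B _ h
    · intro hx'
      have h := h2 μ y' lam (i.supF lam) hBS x'
      rw [Matrix.toLin'_apply, hx'] at h
      simp only at h
      show |dG i μ lam x'| ≤ B
      unfold dG
      rw [← i.dMat_G_mulVec]
      exact sup_to_B _ h
    · intro hx hx'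
      have hblk : blkOf i.D x' = blkOf i.D x := by rw [hx, hx']
      obtain ⟨h4, -⟩ := hpt μ y' lam (i.supF lam) hBS x x' hne' hblk
      have h4' := h4 hxm hxm'
      have hfx : fwd i.NB μ x = ⟨x.1 + Pi.single μ 1, hxm⟩ := Subtype.ext (fwd_val_of_mem μ x hxm)
      have hfx' : fwd i.NB μ x' = ⟨x'.1 + Pi.single μ 1, hxm'⟩ := Subtype.ext (fwd_val_of_mem μ x' hxm')
      rw [lev_eq_of_blkOf_eq i.D hx, hx] at h4'
      show |dG i μ lam x' - dG i μ lam x| / (supNorm (x'.1 - x.1) / (nK i)) ^ α ≤ B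
      rw [quot_eq_weight i α x x' hne']
      unfold dG
      rw [← mul_sub, hfx, hfx']
      exact pair_to_B _ _ h4'
  · -- entry 5: `ζ·G′∇^{η*}_μλ`, site pairs
    refine hqP_le_of_forall i α _ hBB fun x x' hne => ?_
    have hne' : x'.1 ≠ x.1 := fun h => hne (Subtype.ext h).symm
    have hds : dstar 1 μ i.G = i.G * (dMat i.NB μ)ᵀ := B6Prop22KLevelCensus.KIdx.dstar_one_eq μ i.G
    refine holder_pair_boundP i α ζ (Gd i μ lam) y hcut x x' hne hB0 hB0 ?_ ?_ ?_
    · intro hx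
      have h := h3 μ y' lam (i.supF lam) hBS x
      rw [Matrix.toLin'_apply, hx] at h
      simp only at h
      show |Gd i μ lam x| ≤ B
      unfold Gd
      rw [hds]
      exact sup_to_B _ h
    · intro hx'
      have h := h3 μ y' lam (i.supF lam) hBS x'
      rw [Matrix.toLin'_apply, hx'] at h
      simp only at h
      show |Gd i μ lam x'| ≤ B
      unfold Gd
      rw [hds]
      exact sup_to_B _ h
    · intro hx hx'
      have hblk : blkOf i.D x' = blkOf i.D x := by rw [hx, hx']
      obtain ⟨-, h5⟩ := hpt μ y' lam (i.supF lam) hBS x x' hne' hblk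
      rw [lev_eq_of_blkOf_eq i.D hx, hx] at h5
      show |Gd i μ lam x' - Gd i μ lam x| / (supNorm (x'.1 - x.1) / (nK i)) ^ α ≤ B
      rw [quot_eq_weight i α x x' hne']
      unfold Gd
      rw [← mul_sub, hds]
      exact pair_to_B _ _ h5

/-! ## §2 The census sentence of Proposition 2.2, verbatim, on the genuine `k`-level family in print's units -/

/-- **[B6] PROPOSITION 2.2 IN ITS CENSUS TYPING — `B6.Prop22Printed` VERBATIM — FOR THE GENUINE `k`-LEVEL OPERATOR
`G′ = Δ′_a^{−1}` ON EVERY NESTED FAMILY (2.1)–(2.2) OF THE BOX, IN PRINT'S UNITS `η = L^{−k}`**: `∃ M₁ δ₀ C, ∃ Cα : ℝ → ℝ`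
such that for every member `i : KIdx d ℓ` with `M₁ ≤ M`: the four sup entries `|(G′λ)(x)|, |(∇^η_xG′λ)(x)|, |(G′∇^{η*}λ)(x)|,
|(Δ^ηG′λ)(x)| ≤ C·[(L^jη)², L^jη, L^jη, 1]·e^{−½δ₀d(y,y′)}|λ|` (r03's `prop22_supEntries_kLevelP`) AND, for every `0 ≤ α < 1`,
the Hölder entries `‖ζ∇^η_xG′λ‖_α, ‖ζG′∇^{η*}λ‖_α ≤ Cα(α)·(L^jη)^{1−α}(‖ζ‖_α + |ζ|)·e^{−½δ₀d(y,y′)}|λ|` (§1, `Cα` the choice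
function of its constants, `|·|` to make it non-negative off `[0,1)`).  `M₁ := max`, `δ₀ := min` (rates weakened against the
non-negative realised distance).  Non-vacuity beyond every threshold: `B6Prop22KLevelCensusEta.kLevelP_nonvacuous`.
[cite: Balaban1984PropagatorsII, Prop. 2.2 (2.67) p.234; (2.1)–(2.2) p.224; (2.46) p.231; Balaban1983RegularityDecay, Thm (1.9) p.573] -/
theorem prop22Printed_kLevelP (d ℓ : ℕ) (hℓ : 1 ≤ ℓ) :
    Prop22Printed (fun i : KIdx d ℓ => geoP i) (fun i => gpP i) := by
  classical
  obtain ⟨M₁, δ₁, C, hM₁, hδ₁, hC, hS⟩ := prop22_supEntries_kLevelP d ℓ hℓ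
  obtain ⟨M₂, δ₂, hM₂, hδ₂, hH⟩ := prop22_holderEntries_kLevelP_unif d ℓ hℓ
  -- the exponent-dependent constant: the absolute value of the one delivered by §1 on `[0, 1)`, `0` elsewhere
  let Cα : ℝ → ℝ := fun α => if h : 0 ≤ α ∧ α < 1 then |Classical.choose (hH α h.1 h.2)| else 0
  have hCα0 : ∀ α, 0 ≤ Cα α := by
    intro α
    by_cases h : 0 ≤ α ∧ α < 1
    · simp only [Cα, dif_pos h]; exact abs_nonneg _
    · simp only [Cα, dif_neg h]; exact le_rfl
  -- positivity of the factors of the target, on the print-unit geometry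
  have hsup0 : ∀ (i : KIdx d ℓ) (lam : (geoP i).Loc), 0 ≤ (geoP i).supNorm lam := fun i lam => supF_nonneg i lam
  have hcut0 : ∀ (i : KIdx d ℓ) (α : ℝ) (ζ : (geoP i).Cut), 0 ≤ (geoP i).cutH α ζ := by
    intro i α ζ
    change 0 ≤ hqP i α ζ + i.supF ζ
    have := hqP_nonneg i α ζ; have := supF_nonneg i ζ; positivity
  have hdist0 : ∀ (i : KIdx d ℓ) (y y' : (geoP i).Site), 0 ≤ (geoP i).dist y y' := by
    intro i y y'
    change (0 : ℝ) ≤ (((bond i.D).dist y y' : ℕ) : ℝ); exact Nat.cast_nonneg _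
  have hEmono : ∀ (i : KIdx d ℓ) (δ : ℝ) (y y' : (geoP i).Site), min δ₁ δ₂ ≤ δ →
      Real.exp (-(δ / 2 * (geoP i).dist y y')) ≤ Real.exp (-(min δ₁ δ₂ / 2 * (geoP i).dist y y')) := by
    intro i δ y y' hδ
    apply Real.exp_le_exp.2
    have := mul_le_mul_of_nonneg_right (div_le_div_of_nonneg_right hδ (by norm_num : (0 : ℝ) ≤ 2)) (hdist0 i y y')
    linarith
  have hCα : ∀ α (h0 : 0 ≤ α) (h1 : α < 1), ∀ i : KIdx d ℓ, (geoP i).Hyp21_22 → M₂ ≤ (geoP i).M →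
      ∀ (lam : (geoP i).Loc) (ζ : (geoP i).Cut) (y y' : (geoP i).Site), (geoP i).cutIn ζ y → (geoP i).suppIn lam y' →
        (gpP i).h1 lam α ζ ≤ Cα α * ((geoP i).len y) ^ (1 - α) * (geoP i).cutH α ζ *
          Real.exp (-(δ₂ / 2 * (geoP i).dist y y')) * (geoP i).supNorm lam := by
    intro α h0 h1 i hHyp hM lam ζ y y' hcut hsupp
    have e : Cα α = |Classical.choose (hH α h0 h1)| := by
      simp only [Cα, dif_pos (And.intro h0 h1)]
    rw [e]
    have h := (Classical.choose_spec (hH α h0 h1)).2 i hHyp hM lam ζ y y' hcut hsupp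
    refine h.trans ?_
    have hl0 : 0 ≤ ((geoP i).len y) ^ (1 - α) := Real.rpow_nonneg (len_pos i y).le _
    have hP : 0 ≤ ((geoP i).len y) ^ (1 - α) * (geoP i).cutH α ζ * Real.exp (-(δ₂ / 2 * (geoP i).dist y y')) *
        (geoP i).supNorm lam := by
      have := hcut0 i α ζ; have := hsup0 i lam; positivity
    have := mul_le_mul_of_nonneg_right (le_abs_self (Classical.choose (hH α h0 h1))) hP
    calc Classical.choose (hH α h0 h1) * ((geoP i).len y) ^ (1 - α) * (geoP i).cutH α ζ *
          Real.exp (-(δ₂ / 2 * (geoP i).dist y y')) * (geoP i).supNorm lam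
        = Classical.choose (hH α h0 h1) * (((geoP i).len y) ^ (1 - α) * (geoP i).cutH α ζ *
          Real.exp (-(δ₂ / 2 * (geoP i).dist y y')) * (geoP i).supNorm lam) := by ring
      _ ≤ |Classical.choose (hH α h0 h1)| * (((geoP i).len y) ^ (1 - α) * (geoP i).cutH α ζ *
          Real.exp (-(δ₂ / 2 * (geoP i).dist y y')) * (geoP i).supNorm lam) := this
      _ = _ := by ring
  refine ⟨max M₁ M₂, min δ₁ δ₂, C, Cα, lt_max_of_lt_left hM₁, lt_min hδ₁ hδ₂, hC, ?_⟩
  intro i hHyp hM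
  refine ⟨fun m lam y y' hsupp => ?_, fun α lam ζ y y' hα0 hα1 hcut hsupp => ?_⟩
  · have h := hS i hHyp ((le_max_left _ _).trans hM) m lam y y' hsupp
    refine h.trans ?_
    have hp : 0 ≤ pref4 ((geoP i).len y) m := by
      have := (len_pos i y).le
      fin_cases m <;> simp [pref4] <;> positivity
    exact mul_le_mul_of_nonneg_right (mul_le_mul_of_nonneg_left (hEmono i δ₁ y y' (min_le_left _ _)) (by positivity))
      (hsup0 i lam)
  · have h := hCα α hα0 hα1 i hHyp ((le_max_right _ _).trans hM) lam ζ y y' hcut hsupp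
    refine h.trans ?_
    have hl : 0 ≤ ((geoP i).len y) ^ (1 - α) := Real.rpow_nonneg (len_pos i y).le _
    have h0 : 0 ≤ Cα α * ((geoP i).len y) ^ (1 - α) * (geoP i).cutH α ζ :=
      mul_nonneg (mul_nonneg (hCα0 α) hl) (hcut0 i α ζ)
    exact mul_le_mul_of_nonneg_right (mul_le_mul_of_nonneg_left (hEmono i δ₂ y y' (min_le_right _ _)) h0) (hsup0 i lam)

end Literature.MathematicalPhysics.QuantumFieldTheory.Balaban1983to89.B6Prop22KLevelCensusEtaUnif
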